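import Literature.Barriers.AnomalousDissipation.CodimensionOneRigidity
import Literature.Analysis.FunctionSpaces.TorusSpaceTime
import HarnessLib

/-!
# The `BV` bound of the gradient pairing on `T^d` and bounded representatives

Support file for the discharge of the named fact
`Literature.Barriers.AnomalousDissipation.DeRosaInversi2024_thm12` (`CodimensionOneRigidity.lean`):
the first half of the structure step (De Rosa–Inversi 2024, §2.2, `BV(Ω) = {f ∈ L¹ : ∇f ∈ ℳ}`,
and §4). From the definition of the total variation `torusTotalVariation v = |Dv|(T^d)` by
duality we extract the pairing bound actually used downstream:

* `enorm_integral_mul_partialDeriv_le`: `|∫ vᵢ ∂ⱼθ| ≤ (sup |θ|) |Dv|(T^d)` for smooth `θ`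
  (test the supremum defining `|Dv|` with the field `Φᵢ = (θ/S) eⱼ`, `Φ_{i'} = 0` otherwise);
* `enorm_integral_integral_le`: the space–time version
  `|∫∫ ζ(t) uᵢ ∂ⱼφ| ≤ (sup_{[a,b] × T^d} |φ|) ∫_{[a,b]} |Du(t)|(T^d) dt` for a time cut-off `ζ`
  supported in `[a, b]` with `|ζ| ≤ 1` — with the *lower* Lebesgue integral of `t ↦ |Du(t)|`, so
  that no measurability of the total variation in time is needed;
* `exists_bounded_representative`: an `L^∞` field measurable on a slab has a bounded, strongly
  measurable representative (used to run all later Fubini arguments with bounded integrands).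

Everything is proved; theorems only.

## References

* L. De Rosa, M. Inversi, Comm. Math. Phys. 405 (2024), §2.2, §4 (arXiv:2307.09189).
* L. Ambrosio, N. Fusco, D. Pallara, *Functions of Bounded Variation and Free Discontinuity
  Problems* (2000), Def. 3.4, Prop. 3.6.
-/

noncomputable section

open MeasureTheory TopologicalSpace Set Function Filter Topology
open scoped ENNReal NNReal RealInnerProductSpace

namespace Literature.Barriers.AnomalousDissipation

namespace CodimensionOneRigidity

open Literature.Analysis Literature.Analysis.FunctionSpaces Literature.Analysis.FluidPDE

variable {d : Type} [Fintype d] [DecidableEq d]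

/-! ### Divergence of the test fields `(c θ) eⱼ` -/

/-- The zero field has zero divergence (pointwise calculus on the torus). [folklore] -/
theorem divergence_zero (x : UnitAddTorus d) :
    Torus.divergence (fun _ => (0 : EuclideanSpace ℝ d)) x = 0 := by
  unfold Torus.divergence Torus.partialDeriv Torus.lineDeriv
  simp

/-- `div ((c θ) eⱼ) = c ∂ⱼθ` for a smooth scalar `θ` and a constant `c`. [folklore] -/
theorem divergence_smul_single {θ : UnitAddTorus d → ℝ} (hθ : Torus.IsSmooth θ) (c : ℝ) (j : d)
    (x : UnitAddTorus d) :
    Torus.divergence (fun y => (c * θ y) • EuclideanSpace.single j (1 : ℝ)) x =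
      c * Torus.partialDeriv j θ x := by
  unfold Torus.divergence
  have hcomp : ∀ k : d, (fun y => ((c * θ y) • EuclideanSpace.single j (1 : ℝ)) k) =
      (EuclideanSpace.single j (1 : ℝ) k * c) • θ := by
    intro k
    funext y
    simp only [PiLp.smul_apply, smul_eq_mul, Pi.smul_apply]
    ring
  simp_rw [hcomp, Torus.partialDeriv_const_smul (hθ.isContDiff (by simp))]
  simp only [Pi.smul_apply, smul_eq_mul, PiLp.single_apply, ite_mul, one_mul, zero_mul,
    Finset.sum_ite_eq', Finset.mem_univ, if_true]

/-! ### The pairing bound `|∫ vᵢ ∂ⱼθ| ≤ sup|θ| · |Dv|(T^d)` -/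

/-- One-sided form of the pairing bound: `S⁻¹ ∫ vᵢ ∂ⱼθ ≤ |Dv|(T^d)` when `|θ| ≤ S`
(test the supremum defining `torusTotalVariation` with `Φᵢ = (θ/S) eⱼ`, `Φ_{i'} = 0`). [folklore] -/
theorem ofReal_inv_mul_integral_le_torusTotalVariation (v : UnitAddTorus d → EuclideanSpace ℝ d)
    {θ : UnitAddTorus d → ℝ} (hθ : Torus.IsSmooth θ) {S : ℝ} (hS : 0 < S) (hθS : ∀ x, |θ x| ≤ S)
    (i j : d) :
    ENNReal.ofReal (S⁻¹ * ∫ x, v x i * Torus.partialDeriv j θ x) ≤ torusTotalVariation v := by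
  set Φ : d → UnitAddTorus d → EuclideanSpace ℝ d := fun i' =>
    if i' = i then fun y => (S⁻¹ * θ y) • EuclideanSpace.single j (1 : ℝ) else fun _ => 0 with hΦ
  have hΦs : ∀ i', Torus.IsSmooth (Φ i') := by
    intro i'
    by_cases h : i' = i
    · simp only [hΦ, h, if_true]
      exact (hθ.smul S⁻¹).smul' (Torus.isSmooth_const _)
    · simp only [hΦ, h, if_false]
      exact Torus.isSmooth_const _
  have hΦ1 : ∀ x, ∑ i', ‖Φ i' x‖ ^ 2 ≤ 1 := by
    intro x
    have h' : ∀ i', ‖Φ i' x‖ ^ 2 = if i' = i then (S⁻¹ * θ x) ^ 2 else 0 := by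
      intro i'
      by_cases h : i' = i
      · simp [hΦ, h, norm_smul, mul_pow, sq_abs]
      · simp [hΦ, h]
    simp_rw [h', Finset.sum_ite_eq', Finset.mem_univ, if_true]
    have h1 : |S⁻¹ * θ x| ≤ 1 := by
      rw [abs_mul, abs_of_pos (inv_pos.2 hS), inv_mul_le_iff₀ hS, mul_one]
      exact hθS x
    have h2 : 0 ≤ |S⁻¹ * θ x| := abs_nonneg _
    nlinarith [sq_abs (S⁻¹ * θ x)]
  have hsum : ∀ x, ∑ i', v x i' * Torus.divergence (Φ i') x =
      S⁻¹ * (v x i * Torus.partialDeriv j θ x) := by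
    intro x
    have h' : ∀ i', v x i' * Torus.divergence (Φ i') x =
        if i' = i then S⁻¹ * (v x i * Torus.partialDeriv j θ x) else 0 := by
      intro i'
      by_cases h : i' = i
      · subst h
        simp only [hΦ, if_true]
        rw [divergence_smul_single hθ S⁻¹ j x]
        ring
      · simp only [hΦ, h, if_false]
        rw [divergence_zero, mul_zero]
    simp_rw [h', Finset.sum_ite_eq', Finset.mem_univ, if_true]
  have h := ofReal_integral_le_torusTotalVariation v hΦs hΦ1
  simp_rw [hsum] at h
  rwa [integral_const_mul] at h

/-- **The pairing bound from the duality definition of `|Dv|`**: for a smooth `θ` with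
`|θ| ≤ S` (`S > 0`), `‖∫ vᵢ ∂ⱼθ‖ₑ ≤ S · |Dv|(T^d)` (De Rosa–Inversi 2024, §2.2:
`∇v ∈ ℳ(T^d; ℝ^{d×d})` with `‖∇v‖_ℳ = |Dv|(T^d)`; Ambrosio–Fusco–Pallara, Prop. 3.6). [cite: DeRosaInversi2024, §2.2] -/
theorem enorm_integral_mul_partialDeriv_le (v : UnitAddTorus d → EuclideanSpace ℝ d)
    {θ : UnitAddTorus d → ℝ} (hθ : Torus.IsSmooth θ) {S : ℝ} (hS : 0 < S) (hθS : ∀ x, |θ x| ≤ S)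
    (i j : d) :
    ‖∫ x, v x i * Torus.partialDeriv j θ x‖ₑ ≤ ENNReal.ofReal S * torusTotalVariation v := by
  have h1 := ofReal_inv_mul_integral_le_torusTotalVariation v hθ hS hθS i j
  have hθ' : Torus.IsSmooth ((-1 : ℝ) • θ) := hθ.smul (-1)
  have h2 := ofReal_inv_mul_integral_le_torusTotalVariation v hθ' hS
    (fun x => by simpa using hθS x) i j
  rw [Torus.partialDeriv_const_smul (hθ.isContDiff (by simp)) (-1) j] at h2
  simp only [Pi.smul_apply, smul_eq_mul, neg_mul, one_mul, mul_neg, integral_neg] at h2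
  set I : ℝ := ∫ x, v x i * Torus.partialDeriv j θ x with hI
  have habs : ENNReal.ofReal |S⁻¹ * I| ≤ torusTotalVariation v := by
    rcases le_total 0 (S⁻¹ * I) with h | h
    · rwa [abs_of_nonneg h]
    · rwa [abs_of_nonpos h]
  calc ‖I‖ₑ = ENNReal.ofReal |I| := Real.enorm_eq_ofReal_abs I
    _ = ENNReal.ofReal (S * |S⁻¹ * I|) := by
        rw [abs_mul, abs_of_pos (inv_pos.2 hS), ← mul_assoc, mul_inv_cancel₀ hS.ne', one_mul]
    _ = ENNReal.ofReal S * ENNReal.ofReal |S⁻¹ * I| := ENNReal.ofReal_mul hS.le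
    _ ≤ ENNReal.ofReal S * torusTotalVariation v := by gcongr

/-- **Space–time pairing bound** (De Rosa–Inversi 2024, §4, the role of the hypothesis
`u ∈ L¹(I; BV)`): for a time cut-off `ζ` supported in `[a, b]` with `|ζ| ≤ 1` and a smooth
space–time `φ` with `|φ| ≤ S` on `[a, b] × T^d`,
`‖∫∫ ζ(t) wᵢ ∂ⱼφ dx dt‖ₑ ≤ S ∫⁻_{[a,b]} |Dw(t)|(T^d) dt`. The lower integral of the (possibly
non-measurable) function `t ↦ |Dw(t)|(T^d)` is exactly what the fact assumes finite. [cite: DeRosaInversi2024, §4] -/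
theorem enorm_integral_integral_le (w : ℝ → UnitAddTorus d → EuclideanSpace ℝ d) {a b : ℝ}
    {ζ : ℝ → ℝ} (hζ1 : ∀ t, |ζ t| ≤ 1) (hζ0 : ∀ t ∉ Icc a b, ζ t = 0)
    {φ : ℝ → UnitAddTorus d → ℝ} (hφ : ∀ t, Torus.IsSmooth (φ t)) {S : ℝ} (hS : 0 < S)
    (hφS : ∀ t ∈ Icc a b, ∀ x, |φ t x| ≤ S) (i j : d) :
    ‖∫ t, ∫ x, ζ t * (w t x i * Torus.partialDeriv j (φ t) x)‖ₑ ≤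
      ENNReal.ofReal S * ∫⁻ t in Icc a b, torusTotalVariation (w t) := by
  calc ‖∫ t, ∫ x, ζ t * (w t x i * Torus.partialDeriv j (φ t) x)‖ₑ
      ≤ ∫⁻ t, ‖∫ x, ζ t * (w t x i * Torus.partialDeriv j (φ t) x)‖ₑ :=
        enorm_integral_le_lintegral_enorm _
    _ ≤ ∫⁻ t, (Icc a b).indicator (fun t => ENNReal.ofReal S * torusTotalVariation (w t)) t := by
        refine lintegral_mono fun t => ?_
        rw [integral_const_mul, enorm_mul]
        by_cases ht : t ∈ Icc a b
        · rw [indicator_of_mem ht]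
          have hζt : ‖ζ t‖ₑ ≤ 1 := by
            rw [Real.enorm_eq_ofReal_abs]
            exact ENNReal.ofReal_le_one.2 (hζ1 t)
          calc ‖ζ t‖ₑ * ‖∫ x, w t x i * Torus.partialDeriv j (φ t) x‖ₑ
              ≤ 1 * (ENNReal.ofReal S * torusTotalVariation (w t)) :=
                mul_le_mul' hζt (enorm_integral_mul_partialDeriv_le (w t) (hφ t) hS (hφS t ht) i j)
            _ = _ := one_mul _
        · rw [indicator_of_notMem ht, hζ0 t ht]
          simp
    _ = ENNReal.ofReal S * ∫⁻ t in Icc a b, torusTotalVariation (w t) := by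
        rw [lintegral_indicator measurableSet_Icc, lintegral_const_mul' _ _ ENNReal.ofReal_ne_top]

/-! ### Bounded strongly measurable representatives -/

omit [DecidableEq d] in
/-- **Bounded representative.** A field `u : ℝ → T^d → ℝ^d` that is a.e.-strongly measurable on
the slab `[a, b] × T^d` and essentially bounded by `Mbd ≥ 0` there (slice-wise) agrees a.e. on
the slab — and slice-wise at a.e. time — with a field `w` that is strongly measurable and bounded
by `Mbd` everywhere. [folklore] -/
theorem exists_bounded_representative {u : ℝ → UnitAddTorus d → EuclideanSpace ℝ d}
    {a b Mbd : ℝ} (hMbd : 0 ≤ Mbd)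
    (hmeas : AEStronglyMeasurable (uncurry u) (volume.restrict (Icc a b ×ˢ univ)))
    (hbdd : ∀ᵐ t ∂(volume.restrict (Icc a b)), ∀ᵐ x : UnitAddTorus d, ‖u t x‖ ≤ Mbd) :
    ∃ w : ℝ → UnitAddTorus d → EuclideanSpace ℝ d, StronglyMeasurable (uncurry w) ∧
      (∀ t x, ‖w t x‖ ≤ Mbd) ∧
      (uncurry w =ᵐ[volume.restrict (Icc a b ×ˢ univ)] uncurry u) ∧
      ∀ᵐ t ∂(volume.restrict (Icc a b)), w t =ᵐ[volume] u t := by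
  have hprod : (volume.restrict (Icc a b ×ˢ (univ : Set (UnitAddTorus d)))) =
      (volume.restrict (Icc a b)).prod volume := by
    rw [Measure.volume_eq_prod, Measure.restrict_prod_eq_prod_univ]
  rw [hprod] at hmeas ⊢
  set u₀ : ℝ × UnitAddTorus d → EuclideanSpace ℝ d := hmeas.mk (uncurry u) with hu₀def
  have hu₀m : StronglyMeasurable u₀ := hmeas.stronglyMeasurable_mk
  have hu₀ : uncurry u =ᵐ[(volume.restrict (Icc a b)).prod volume] u₀ := hmeas.ae_eq_mk
  have hslice : ∀ᵐ t ∂(volume.restrict (Icc a b)), ∀ᵐ x : UnitAddTorus d,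
      uncurry u (t, x) = u₀ (t, x) := Measure.ae_ae_of_ae_prod hu₀
  have hs : MeasurableSet {q : ℝ × UnitAddTorus d | ‖u₀ q‖ ≤ Mbd} :=
    hu₀m.norm.measurableSet_le stronglyMeasurable_const
  have hb₀ : ∀ᵐ q ∂((volume.restrict (Icc a b)).prod (volume : Measure (UnitAddTorus d))),
      ‖u₀ q‖ ≤ Mbd := by
    refine (Measure.ae_prod_mem_iff_ae_ae_mem hs).2 ?_
    filter_upwards [hbdd, hslice] with t ht ht'
    filter_upwards [ht, ht'] with x hx hx'
    show ‖u₀ (t, x)‖ ≤ Mbd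
    rw [← hx']
    exact hx
  set w₀ : ℝ × UnitAddTorus d → EuclideanSpace ℝ d := fun q => if ‖u₀ q‖ ≤ Mbd then u₀ q else 0
    with hw₀def
  have hw₀m : StronglyMeasurable w₀ := StronglyMeasurable.ite hs hu₀m stronglyMeasurable_const
  have hw₀b : ∀ q, ‖w₀ q‖ ≤ Mbd := fun q => by
    by_cases h : ‖u₀ q‖ ≤ Mbd
    · simp only [hw₀def, h, if_true]
    · simp only [hw₀def, h, if_false, norm_zero]
      exact hMbd
  have hw₀ae : w₀ =ᵐ[(volume.restrict (Icc a b)).prod volume] uncurry u := by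
    filter_upwards [hb₀, hu₀] with q hq hq'
    simp only [hw₀def, hq, if_true]
    exact hq'.symm
  refine ⟨fun t x => w₀ (t, x), hw₀m, fun t x => hw₀b _, hw₀ae, ?_⟩
  filter_upwards [Measure.ae_ae_of_ae_prod hw₀ae] with t ht
  exact ht

end CodimensionOneRigidity

end Literature.Barriers.AnomalousDissipation

end
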